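import Summits.Ventures.HodgeRepro2.T5TensorLatticeSplitStabilizer
import Summits.Ventures.HodgeRepro2.T5HeckeIsomorphismTransport
import Summits.Ventures.HodgeRepro2.T5InertPlaceCompletion
import Summits.Ventures.HodgeRepro2.T5GlobalLatticeAlmostAll

/-!
# The record's `K_v` as a subgroup, and its spherical Hecke algebra (cell pub-hodge-repro2, seat p3)

The capstone of files 224–230. The record's `K_v` at a finite place `v` of `K⁺` is the STABILISER of the tensor
lattice `Λ^n` in the isometry group of `1 ⊗ H` over `K⁺_v ⊗ K` (`recordHyperspecial`, built from the generic
`stabSubgroup` of a lattice in `GL_n(E)`). With the identifications of files 226 / 228 (non-split) and 225 / 230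
(split), seat p8's T5-142 transports the Hecke algebra:
* **`recordHeckeEquiv`** — at a non-split place, `H(U(1 ⊗ H), K_v) ≃ₐ[k] H(U(H_w), hyperspecialSubgroup 𝒪_w H_w)`
  (seat p8's Hecke algebra of the N3 lane), and `heckeAlgebra_mul_comm_record_nonSplit` — its commutativity from
  p8's T5-146 (`heckeAlgebra_mul_comm_adicCompletion'`) for the rank-3 Gram matrix of the datum at an inert place
  where `H` is unimodular (file 222's good places), the isotropic vector supplied by file 180;
* **`recordHeckeEquivSplit`** — at a split place, `H(U(1 ⊗ H), K_v) ≃ₐ[k] H(U((H_w, H_wᵀ)), U ∩ GL_n(𝒪_w × 𝒪_w))`,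
  and `heckeAlgebra_mul_comm_record_split` — its commutativity from file 224 at a good place.
So the spherical Hecke algebra of the record's own local pair is commutative at every good finite place: split
places unconditionally, inert places under seat p8's standing hypotheses (the rank `3`, `e = 1`).

Mathlib + this seat's files 222 / 180 / 224–230 + seat p8's T5-142 (T5HeckeIsomorphismTransport) / T5-146
(T5InertPlaceCompletion) and their imports; no display; no device. §8(d): uses an L-value-free non-vanishing
device: NO.
-/

namespace Summit.Ventures.HodgeRepro2.T5RecordHyperspecial

open Matrix NumberField NumberField.IsCMField IsDedekindDomain IsDedekindDomain.HeightOneSpectrum Module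
open scoped TensorProduct Pointwise
open Summit.Ventures.HodgeRepro2.T5UnitaryGroupForm Summit.Ventures.HodgeRepro2.T5UnitaryHeckeAdjoint
  Summit.Ventures.HodgeRepro2.T5SplitUnitaryGroupEquiv Summit.Ventures.HodgeRepro2.T5SplitPlaceUnitaryGroup
  Summit.Ventures.HodgeRepro2.T5NonSplitPlaceUnitaryGroup Summit.Ventures.HodgeRepro2.T5TensorLatticeNonSplit
  Summit.Ventures.HodgeRepro2.T5TensorLatticeSplit Summit.Ventures.HodgeRepro2.T5TensorLatticeSplitStabilizer
  Summit.Ventures.HodgeRepro2.T5FinitePlaceSplitClassification Summit.Ventures.HodgeRepro2.T5FinitePlaceCM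
  Summit.Ventures.HodgeRepro2.T5SplitUnitaryGroup Summit.Ventures.HodgeRepro2.T5HeckeIsomorphismTransport
  Summit.Ventures.HodgeRepro2.T5HeckePermutationModule Summit.Ventures.HodgeRepro2.T5StarOfInvolution
  Summit.Ventures.HodgeRepro2.T5FinitePlaceNormIndex Summit.Ventures.HodgeRepro2.T5GlobalLatticeAlmostAll
  Summit.Ventures.HodgeRepro2.T5HermitianLocalIsotropyN3 Summit.Ventures.HodgeRepro2.T5UnitaryGroupIsometry
  Summit.Ventures.HodgeRepro2.T5SplitHermitianClass

/-! ## The stabiliser of a lattice in `GL_n(E)` -/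

section Stab

variable {E : Type*} [CommRing E] {n : Type*} [Fintype n] [DecidableEq n]

/-- The stabiliser of a set of vectors `L` in `GL_n(E)`: `{u | u(L) = L}`. -/
def stabSubgroup (L : Set (n → E)) : Subgroup (GL n E) where
  carrier := {u | (fun x => (u : Matrix n n E).mulVec x) '' L = L}
  one_mem' := by
    show (fun x => ((1 : GL n E) : Matrix n n E).mulVec x) '' L = L
    simp only [Units.val_one, Matrix.one_mulVec, Set.image_id']
  mul_mem' {u v} hu hv := by
    show (fun x => ((u * v : GL n E) : Matrix n n E).mulVec x) '' L = L
    have hu' : (fun x => (u : Matrix n n E).mulVec x) '' L = L := hu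
    have hv' : (fun x => (v : Matrix n n E).mulVec x) '' L = L := hv
    rw [Units.val_mul]
    conv_rhs => rw [← hu', ← hv']
    rw [Set.image_image]
    exact congrArg (· '' L) (funext fun x => (Matrix.mulVec_mulVec x _ _).symm)
  inv_mem' {u} hu := by
    show (fun x => ((u⁻¹ : GL n E) : Matrix n n E).mulVec x) '' L = L
    have hu' : (fun x => (u : Matrix n n E).mulVec x) '' L = L := hu
    conv_lhs => rw [← hu']
    rw [Set.image_image]
    have : (fun x => ((u⁻¹ : GL n E) : Matrix n n E).mulVec ((u : Matrix n n E).mulVec x)) = id := by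
      funext x
      rw [Matrix.mulVec_mulVec, ← Units.val_mul, inv_mul_cancel, Units.val_one, Matrix.one_mulVec]
      rfl
    rw [this, Set.image_id]

/-- Membership in the stabiliser. -/
theorem mem_stabSubgroup_iff (L : Set (n → E)) (u : GL n E) :
    u ∈ stabSubgroup L ↔ (fun x => (u : Matrix n n E).mulVec x) '' L = L := Iff.rfl

end Stab

/-- Commutativity transports backwards along an algebra isomorphism (stated over abstract carriers, to be
instantiated in term mode — the Subalgebra instance diamond of `↥(heckeAlgebra k K)` makes a direct `rw` time out). -/
theorem mul_comm_of_algEquiv {k A B : Type*} [CommSemiring k] [Semiring A] [Semiring B] [Algebra k A] [Algebra k B]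
    (e : A ≃ₐ[k] B) (h : ∀ x y : B, x * y = y * x) (a b : A) : a * b = b * a :=
  e.injective (by rw [map_mul, map_mul, h])

/-! ## The record's `K_v` and its Hecke algebra at a non-split place -/

section NonSplit

variable (K : Type*) [Field K] [NumberField K] [IsCMField K]
variable (v : HeightOneSpectrum (𝓞 (maximalRealSubfield K))) (w : HeightOneSpectrum (𝓞 K))
  [w.asIdeal.LiesOver v.asIdeal]
variable {θ : maximalRealSubfield K} {y : K}
  (hθ : algebraMap (maximalRealSubfield K) K θ = y ^ 2) (hy : complexConj K y ≠ y)
  (hsq : ¬ IsSquare (algebraMap (maximalRealSubfield K) (v.adicCompletion (maximalRealSubfield K)) θ))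
variable {r : ℕ} (l : Fin r → 𝓞 K) {n : Type*} [Fintype n] [DecidableEq n]

/-- **THE RECORD'S `K_v`**: the stabiliser of the tensor lattice `Λ^n` in the isometry group of `1 ⊗ H`. -/
noncomputable def recordHyperspecial (H : Matrix n n K) :
    Subgroup (letI := tensorStarRing K v; ↥(formUnitaryGroup (tensorGram K v H))) :=
  letI := tensorStarRing K v
  (stabSubgroup (tensorStdLattice K v l (n := n))).subgroupOf (formUnitaryGroup (tensorGram K v H))

/-- Membership in the record's `K_v`. -/
theorem mem_recordHyperspecial_iff (H : Matrix n n K)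
    (g : (letI := tensorStarRing K v; ↥(formUnitaryGroup (tensorGram K v H)))) :
    g ∈ recordHyperspecial K v l H ↔
      (fun x : n → (v.adicCompletion (maximalRealSubfield K)) ⊗[maximalRealSubfield K] K =>
        (g.1 : Matrix n n _).mulVec x) '' tensorStdLattice K v l (n := n) = tensorStdLattice K v l := by
  letI := tensorStarRing K v
  rw [recordHyperspecial, Subgroup.mem_subgroupOf]
  exact Iff.rfl

/-- The record's `K_v` corresponds to seat p8's `hyperspecialSubgroup` under `recordNonSplitEquiv'` (file 228). -/
theorem mem_recordHyperspecial_iff_nonSplit (hl : Submodule.span (𝓞 (maximalRealSubfield K)) (Set.range l) = ⊤)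
    (H : Matrix n n K) (g : (letI := tensorStarRing K v; ↥(formUnitaryGroup (tensorGram K v H)))) :
    g ∈ recordHyperspecial K v l H ↔
      (letI := starRingOfQuadratic (finrank_eq_two K v w hθ hy hsq)
          (localConj v w hθ.symm (span_pair_eq_top K hy) hsq (complexConj K))
          (localConj_ne_one v w hθ.symm (span_pair_eq_top K hy) hsq (complexConj K)
            (complexConj_apply_eq_neg K hθ hy));
        recordNonSplitEquiv' K v w hθ hy hsq H g ∈
          hyperspecialSubgroup (w.adicCompletionIntegers K) (H.map (algebraMap K (w.adicCompletion K)))) :=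
  (mem_recordHyperspecial_iff K v l H g).trans
    (image_tensorStdLattice_eq_iff_mem_hyperspecialSubgroup K v w hθ hy hsq l hl H g)

/-- **THE RECORD'S SPHERICAL HECKE ALGEBRA IS SEAT p8's** at a non-split place:
`H(U(1 ⊗ H), K_v) ≃ₐ[k] H(U(H_w), hyperspecialSubgroup 𝒪_w H_w)` (seat p8's T5-142 transport along file 226's
isomorphism, with file 228's identification of the subgroups). -/
noncomputable def recordHeckeEquiv (k : Type*) [Field k]
    (hl : Submodule.span (𝓞 (maximalRealSubfield K)) (Set.range l) = ⊤) (H : Matrix n n K) :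
    (letI := tensorStarRing K v; ↥(heckeAlgebra k (recordHyperspecial K v l H))) ≃ₐ[k]
      (letI := starRingOfQuadratic (finrank_eq_two K v w hθ hy hsq)
          (localConj v w hθ.symm (span_pair_eq_top K hy) hsq (complexConj K))
          (localConj_ne_one v w hθ.symm (span_pair_eq_top K hy) hsq (complexConj K)
            (complexConj_apply_eq_neg K hθ hy));
        ↥(heckeAlgebra k (hyperspecialSubgroup (w.adicCompletionIntegers K)
          (H.map (algebraMap K (w.adicCompletion K)))))) := by
  letI := tensorStarRing K v
  letI := starRingOfQuadratic (finrank_eq_two K v w hθ hy hsq)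
    (localConj v w hθ.symm (span_pair_eq_top K hy) hsq (complexConj K))
    (localConj_ne_one v w hθ.symm (span_pair_eq_top K hy) hsq (complexConj K)
      (complexConj_apply_eq_neg K hθ hy))
  exact heckeAlgebraEquivOfMulEquiv k (recordNonSplitEquiv' K v w hθ hy hsq H)
    (mem_recordHyperspecial_iff_nonSplit K v w hθ hy hsq l hl H)

omit [Fintype n] [DecidableEq n] in
/-- `H_w` is hermitian for seat p8's star when `H` is hermitian over the CM field. -/
theorem isHermitian_map_p8 {H : Matrix n n K} (hH : H.IsHermitian) :
    letI := starRingOfQuadratic (finrank_eq_two K v w hθ hy hsq)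
      (localConj v w hθ.symm (span_pair_eq_top K hy) hsq (complexConj K))
      (localConj_ne_one v w hθ.symm (span_pair_eq_top K hy) hsq (complexConj K)
        (complexConj_apply_eq_neg K hθ hy))
    (H.map (algebraMap K (w.adicCompletion K))).IsHermitian := by
  letI := starRingOfQuadratic (finrank_eq_two K v w hθ hy hsq)
    (localConj v w hθ.symm (span_pair_eq_top K hy) hsq (complexConj K))
    (localConj_ne_one v w hθ.symm (span_pair_eq_top K hy) hsq (complexConj K)
      (complexConj_apply_eq_neg K hθ hy))
  refine Matrix.ext fun i j => ?_
  rw [Matrix.conjTranspose_apply, Matrix.map_apply, Matrix.map_apply, star_p8_eq_star K v w hθ hy hsq,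
    T5FinitePlaceCM.star_algebraMap K hθ hy v w hsq]
  exact congrArg _ (hH.apply i j)

include hθ hy hsq in
/-- **COMMUTATIVITY OF THE RECORD'S SPHERICAL HECKE ALGEBRA AT AN INERT PLACE** (rank `3`): for the datum's Gram
matrix `H` over `K` (hermitian, invertible) good at `w` (file 222), at an inert place `w ∣ v` of the CM field
(`θ` a `v`-adic non-square, a uniformiser of `O_{K⁺_v}` irreducible in `O_{K_w}`), `H(U(1 ⊗ H), K_v)` is
commutative — seat p8's T5-146 on `(U(H_w), hyperspecialSubgroup)`, transported by `recordHeckeEquiv`; the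
isotropic vector is file 180's. -/
theorem heckeAlgebra_mul_comm_record_nonSplit (k : Type*) [Field k]
    (hl : Submodule.span (𝓞 (maximalRealSubfield K)) (Set.range l) = ⊤)
    {ϖ : v.adicCompletionIntegers (maximalRealSubfield K)} (hϖ : Irreducible ϖ)
    (hinert : Irreducible (algebraMap (v.adicCompletionIntegers (maximalRealSubfield K))
      (w.adicCompletionIntegers K) ϖ))
    {H : Matrix (Fin 3) (Fin 3) K} (hH : H.IsHermitian) (hdet : IsUnit H.det) (hgood : w ∉ badSet H)
    (T S : (letI := tensorStarRing K v; ↥(heckeAlgebra k (recordHyperspecial K v l H)))) :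
    T * S = S * T := by
  letI := tensorStarRing K v
  letI := starRingOfQuadratic (finrank_eq_two K v w hθ hy hsq)
    (localConj v w hθ.symm (span_pair_eq_top K hy) hsq (complexConj K))
    (localConj_ne_one v w hθ.symm (span_pair_eq_top K hy) hsq (complexConj K)
      (complexConj_apply_eq_neg K hθ hy))
  have hHw := isHermitian_map_p8 K v w hθ hy hsq hH
  have hdetw : IsUnit (H.map (algebraMap K (w.adicCompletion K))).det := isUnit_det_map _ H hdet
  have h3 : 2 < Fintype.card (Fin 3) := by rw [Fintype.card_fin]; norm_num
  have hiso := exists_sesqForm_eq_zero_localConj v w hθ.symm (span_pair_eq_top K hy) hsq (complexConj K)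
    (complexConj_apply_eq_neg K hθ hy) (finrank_eq_two K v w hθ hy hsq) (ι := Fin 3) h3
    (H := H.map (algebraMap K (w.adicCompletion K))) hHw hdetw
  obtain ⟨x, hx0, hx⟩ := hiso
  have hint : ∀ i j, IsLocalization.IsInteger (w.adicCompletionIntegers K)
      ((H.map (algebraMap K (w.adicCompletion K))) i j) := fun i j => by
    rw [Matrix.map_apply]
    exact isInteger_of_notMem_badSet hgood i j
  have hint' : ∀ i j, IsLocalization.IsInteger (w.adicCompletionIntegers K)
      ((H.map (algebraMap K (w.adicCompletion K)))⁻¹ i j) := fun i j => by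
    rw [inv_map _ H hdet, Matrix.map_apply]
    exact isInteger_inv_of_notMem_badSet hgood i j
  have hcomm : ∀ T S : heckeAlgebra k (hyperspecialSubgroup (w.adicCompletionIntegers K)
      (H.map (algebraMap K (w.adicCompletion K)))), T * S = S * T :=
    T5InertPlaceCompletion.heckeAlgebra_mul_comm_adicCompletion' v w (finrank_eq_two K v w hθ hy hsq)
      hϖ hinert (localConj v w hθ.symm (span_pair_eq_top K hy) hsq (complexConj K))
      (localConj_ne_one v w hθ.symm (span_pair_eq_top K hy) hsq (complexConj K)
        (complexConj_apply_eq_neg K hθ hy))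
      (H.map (algebraMap K (w.adicCompletion K))) k hHw hint hdetw hint' x hx0 hx
  -- transport the commutativity back along the Hecke-algebra isomorphism
  exact mul_comm_of_algEquiv (recordHeckeEquiv K v w hθ hy hsq l k hl H) hcomm T S

end NonSplit

/-! ## The record's `K_v` and its Hecke algebra at a split place -/

section Split

variable (K : Type*) [Field K] [NumberField K] [IsCMField K]
variable (v : HeightOneSpectrum (𝓞 (maximalRealSubfield K))) (w w' : HeightOneSpectrum (𝓞 K))
  [w.asIdeal.LiesOver v.asIdeal] [w'.asIdeal.LiesOver v.asIdeal]
  (hw : complexConj K • w.asIdeal = w'.asIdeal)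
variable {θ : maximalRealSubfield K} {y : K}
  (hθ : algebraMap (maximalRealSubfield K) K θ = y ^ 2) (hy : complexConj K y ≠ y) (hne : w ≠ w')
  (hsq : IsSquare (algebraMap (maximalRealSubfield K) (v.adicCompletion (maximalRealSubfield K)) θ))
variable {r : ℕ} (l : Fin r → 𝓞 K) {n : Type*} [Fintype n] [DecidableEq n]

/-- The first two stages of file 225's `recordSplitEquiv`: `U(1 ⊗ H) ≃* U((H_w, H_wᵀ))` over `(K_w × K_w, swap)`. -/
noncomputable def splitStageEquiv {H : Matrix n n K} (hH : H.IsHermitian) :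
    (letI := tensorStarRing K v; ↥(formUnitaryGroup (tensorGram K v H))) ≃*
      (letI := swapStarRing (w.adicCompletion K);
        ↥(formUnitaryGroup (hermitianPair (H.map (algebraMap K (w.adicCompletion K)))))) := by
  letI := tensorStarRing K v
  letI := swapStarRing (w.adicCompletion K)
  exact (unitaryMapEquiv (splitEquiv K v w w' hw hθ hy hne hsq) (splitEquiv_star K v w w' hw hθ hy hne hsq)
      (tensorGram K v H)).trans
    (MulEquiv.subgroupCongr (congrArg formUnitaryGroup (tensorGram_map_splitEquiv K v w w' hw hθ hy hne hsq hH)))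

/-- The underlying `GL`-element of `splitStageEquiv g` is `GL.map splitEquiv g`. -/
theorem splitStageEquiv_coe {H : Matrix n n K} (hH : H.IsHermitian)
    (g : (letI := tensorStarRing K v; ↥(formUnitaryGroup (tensorGram K v H)))) :
    ((splitStageEquiv K v w w' hw hθ hy hne hsq hH g).1 : GL n (w.adicCompletion K × w.adicCompletion K)) =
      Matrix.GeneralLinearGroup.map (splitEquiv K v w w' hw hθ hy hne hsq : _ →+* _) g.1 := rfl

/-- The record's `K_v` corresponds to file 224's `splitHyperspecial` under `splitStageEquiv` (file 230). -/
theorem mem_recordHyperspecial_iff_split (hl : Submodule.span (𝓞 (maximalRealSubfield K)) (Set.range l) = ⊤)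
    {H : Matrix n n K} (hH : H.IsHermitian)
    (g : (letI := tensorStarRing K v; ↥(formUnitaryGroup (tensorGram K v H)))) :
    g ∈ recordHyperspecial K v l H ↔
      (letI := swapStarRing (w.adicCompletion K);
        splitStageEquiv K v w w' hw hθ hy hne hsq hH g ∈
          splitHyperspecial (phiw K w) (H.map (algebraMap K (w.adicCompletion K)))) := by
  letI := tensorStarRing K v
  letI := swapStarRing (w.adicCompletion K)
  rw [mem_recordHyperspecial_iff, image_tensorStdLattice_eq_iff_mem_range K v w w' hw hθ hy hne hsq l hl H g,
    splitHyperspecial, Subgroup.mem_subgroupOf, splitStageEquiv_coe]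

/-- **THE RECORD'S SPHERICAL HECKE ALGEBRA AT A SPLIT PLACE** is that of `(U((H_w, H_wᵀ)), U ∩ GL_n(𝒪_w × 𝒪_w))`
(seat p8's T5-142 transport along `splitStageEquiv`, with file 230's identification of the subgroups). -/
noncomputable def recordHeckeEquivSplit (k : Type*) [Field k]
    (hl : Submodule.span (𝓞 (maximalRealSubfield K)) (Set.range l) = ⊤) {H : Matrix n n K} (hH : H.IsHermitian) :
    (letI := tensorStarRing K v; ↥(heckeAlgebra k (recordHyperspecial K v l H))) ≃ₐ[k]
      (letI := swapStarRing (w.adicCompletion K);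
        ↥(heckeAlgebra k (splitHyperspecial (phiw K w) (H.map (algebraMap K (w.adicCompletion K)))))) := by
  letI := tensorStarRing K v
  letI := swapStarRing (w.adicCompletion K)
  exact heckeAlgebraEquivOfMulEquiv k (splitStageEquiv K v w w' hw hθ hy hne hsq hH)
    (mem_recordHyperspecial_iff_split K v w w' hw hθ hy hne hsq l hl hH)

omit [IsCMField K] in
/-- At a good place the Gram matrix `H_w` comes from `GL_n(𝒪_w)`. -/
theorem exists_integral_gram {H : Matrix n n K} (hdet : IsUnit H.det) (hgood : w ∉ badSet H) :
    ∃ A₀ : Matrix n n (w.adicCompletionIntegers K), IsUnit A₀.det ∧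
      A₀.map (algebraMap (w.adicCompletionIntegers K) (w.adicCompletion K)) =
        H.map (algebraMap K (w.adicCompletion K)) := by
  choose a ha using fun i j => isInteger_of_notMem_badSet hgood i j
  choose a' ha' using fun i j => isInteger_inv_of_notMem_badSet hgood i j
  have hmap : (Matrix.of a).map (algebraMap (w.adicCompletionIntegers K) (w.adicCompletion K)) =
      H.map (algebraMap K (w.adicCompletion K)) :=
    Matrix.ext fun i j => ha i j
  have hmap' : (Matrix.of a').map (algebraMap (w.adicCompletionIntegers K) (w.adicCompletion K)) =
      H⁻¹.map (algebraMap K (w.adicCompletion K)) :=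
    Matrix.ext fun i j => ha' i j
  have hinj : Function.Injective fun A : Matrix n n (w.adicCompletionIntegers K) =>
      A.map (algebraMap (w.adicCompletionIntegers K) (w.adicCompletion K)) :=
    Matrix.map_injective Subtype.val_injective
  have h1 : Matrix.of a * Matrix.of a' = 1 := by
    apply hinj
    simp only
    rw [Matrix.map_mul, hmap, hmap', ← Matrix.map_mul, Matrix.mul_nonsing_inv H hdet,
      Matrix.map_one (algebraMap K (w.adicCompletion K)) (map_zero _) (map_one _),
      Matrix.map_one (algebraMap (w.adicCompletionIntegers K) (w.adicCompletion K)) (map_zero _) (map_one _)]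
  refine ⟨Matrix.of a, ?_, hmap⟩
  have hdet1 : (Matrix.of a).det * (Matrix.of a').det = 1 := by rw [← Matrix.det_mul, h1, Matrix.det_one]
  exact ⟨⟨(Matrix.of a).det, (Matrix.of a').det, hdet1, by rw [mul_comm]; exact hdet1⟩, rfl⟩

/-- File 224's commutativity for a Gram matrix `B = A₀.map φ` given as such. -/
theorem heckeAlgebra_mul_comm_split_of_eq {R F : Type*} [CommRing R] [IsDomain R] [Field F] [Algebra R F]
    [IsFractionRing R F] [IsDiscreteValuationRing R] [Finite (IsLocalRing.ResidueField R)]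
    (k : Type*) [Field k] (A₀ : Matrix n n R) (hA₀ : IsUnit A₀.det) (B : Matrix n n F)
    (hB : A₀.map (algebraMap R F) = B)
    (T S : (letI := swapStarRing F; ↥(heckeAlgebra k (splitHyperspecial (algebraMap R F) B)))) : T * S = S * T := by
  subst hB
  exact heckeAlgebra_mul_comm_split k A₀ hA₀ T S

include w' hw hθ hy hne hsq in
/-- **COMMUTATIVITY OF THE RECORD'S SPHERICAL HECKE ALGEBRA AT A SPLIT PLACE**: for the datum's Gram matrix `H`
over `K` (hermitian, invertible) good at `w` (file 222), `H(U(1 ⊗ H), K_v)` is commutative — file 224's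
`heckeAlgebra_mul_comm_split` transported by `recordHeckeEquivSplit`. -/
theorem heckeAlgebra_mul_comm_record_split (k : Type*) [Field k]
    (hl : Submodule.span (𝓞 (maximalRealSubfield K)) (Set.range l) = ⊤)
    {H : Matrix n n K} (hH : H.IsHermitian) (hdet : IsUnit H.det) (hgood : w ∉ badSet H)
    (T S : (letI := tensorStarRing K v; ↥(heckeAlgebra k (recordHyperspecial K v l H)))) :
    T * S = S * T :=
  (exists_integral_gram K w hdet hgood).elim fun A₀ hA₀ =>
    mul_comm_of_algEquiv (recordHeckeEquivSplit K v w w' hw hθ hy hne hsq l k hl hH)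
      (heckeAlgebra_mul_comm_split_of_eq k A₀ hA₀.1 _ hA₀.2) T S

end Split

end Summit.Ventures.HodgeRepro2.T5RecordHyperspecial
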